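import Mathlib
import Summits.MatrixMultiplication.MatrixMultiplication.Theorems.FidelityWitnessesRankTwoAdditivityToolkit

/-!
# `FidelityWitnesses.RankTwoAdditivity` (stmt-MatrixMultiplication-4964) — key lemma, maximally entangled case

Vector Bessel over an orthonormal pair (`bessel_pair_vec`), scaled Bessel for an orthogonal pair of equal norm
(`bessel_pair_scaled`), and the maximally-entangled case of the key lemma for the 2×2 certificate of the core
inequality (`key_case_ME`): `F(φ) ≤ 2s` when `φ 0 ⊥ φ 1` have equal norm `s`.
Supports item `stmt-MatrixMultiplication-4964`; no definitions are introduced.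
-/

namespace Summit.MatrixMultiplication.MatrixMultiplication.Theorems.RankTwoAdditivity

open scoped BigOperators ComplexConjugate

/-- Vector-valued Bessel inequality for an orthonormal pair `w 0, w 1` in `ℂ^α`:
`∑_r ‖∑_a conj (w r a) • g a‖² ≤ ∑_a ‖g a‖²` for vectors `g a ∈ ℂ^μ`. -/
theorem bessel_pair_vec {α μ : Type*} [Fintype α] [Fintype μ] (w : Fin 2 → α → ℂ) (g : α → μ → ℂ)
    (hw₀ : (∑ a, ‖w 0 a‖ ^ 2) = 1) (hw₁ : (∑ a, ‖w 1 a‖ ^ 2) = 1) (hw₀₁ : (∑ a, conj (w 0 a) * w 1 a) = 0) :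
    (∑ r, ∑ c, ‖∑ a, conj (w r a) * g a c‖ ^ 2) ≤ ∑ a, ∑ c, ‖g a c‖ ^ 2 := by
  rw [Fin.sum_univ_two, ← Finset.sum_add_distrib, Finset.sum_comm]
  refine Finset.sum_le_sum fun c _ => ?_
  exact bessel_pair (w 0) (w 1) (fun a => g a c) hw₀.le hw₁.le hw₀₁

/-- Scaled Bessel for an orthogonal pair of equal norm `s`: `|⟪col,φ₀⟫|² + |⟪col,φ₁⟫|² ≤ s ‖col‖²`. -/
theorem bessel_pair_scaled {κ : Type*} [Fintype κ] (φ₀ φ₁ col : κ → ℂ) (s : ℝ)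
    (h₀ : (∑ m, ‖φ₀ m‖ ^ 2) = s) (h₁ : (∑ m, ‖φ₁ m‖ ^ 2) = s) (horth : (∑ m, conj (φ₀ m) * φ₁ m) = 0) :
    ‖∑ m, conj (col m) * φ₀ m‖ ^ 2 + ‖∑ m, conj (col m) * φ₁ m‖ ^ 2 ≤ s * ∑ m, ‖col m‖ ^ 2 := by
  have hs0 : 0 ≤ s := by rw [← h₀]; exact Finset.sum_nonneg fun _ _ => by positivity
  rcases hs0.lt_or_eq with hs | hs
  · -- normalise
    set t : ℝ := (Real.sqrt s)⁻¹ with ht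
    have ht2 : t ^ 2 * s = 1 := by
      rw [ht, inv_pow, Real.sq_sqrt hs.le, inv_mul_cancel₀ hs.ne']
    have htn : ∀ φ : κ → ℂ, (∑ m, ‖φ m‖ ^ 2) = s → (∑ m, ‖(t : ℂ) * φ m‖ ^ 2) = 1 := by
      intro φ hφ
      have : (∑ m, ‖(t : ℂ) * φ m‖ ^ 2) = t ^ 2 * ∑ m, ‖φ m‖ ^ 2 := by
        rw [Finset.mul_sum]; exact Finset.sum_congr rfl fun m _ => by
          rw [norm_mul, Complex.norm_real, Real.norm_eq_abs, mul_pow, sq_abs]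
      rw [this, hφ, ht2]
    have horth' : (∑ m, conj ((t : ℂ) * φ₀ m) * ((t : ℂ) * φ₁ m)) = 0 := by
      have : (∑ m, conj ((t : ℂ) * φ₀ m) * ((t : ℂ) * φ₁ m)) = (t : ℂ) * (t : ℂ) * ∑ m, conj (φ₀ m) * φ₁ m := by
        rw [Finset.mul_sum]; exact Finset.sum_congr rfl fun m _ => by
          rw [map_mul, Complex.conj_ofReal]; ring
      rw [this, horth, mul_zero]
    have hb := bessel_pair (fun m => (t : ℂ) * φ₀ m) (fun m => (t : ℂ) * φ₁ m) col (htn φ₀ h₀).le (htn φ₁ h₁).le horth'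
    have e : ∀ φ : κ → ℂ, ‖∑ m, conj ((t : ℂ) * φ m) * col m‖ ^ 2 = t ^ 2 * ‖∑ m, conj (col m) * φ m‖ ^ 2 := by
      intro φ
      rw [norm_hsum_comm _ col]
      have : (∑ m, conj (col m) * ((t : ℂ) * φ m)) = (t : ℂ) * ∑ m, conj (col m) * φ m := by
        rw [Finset.mul_sum]; exact Finset.sum_congr rfl fun m _ => by ring
      rw [this, norm_mul, Complex.norm_real, Real.norm_eq_abs, mul_pow, sq_abs]
    simp only [e] at hb
    -- multiply by s:  s t² = 1
    have := mul_le_mul_of_nonneg_left hb hs.le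
    have e2 : s * (t ^ 2 * ‖∑ m, conj (col m) * φ₀ m‖ ^ 2 + t ^ 2 * ‖∑ m, conj (col m) * φ₁ m‖ ^ 2)
        = ‖∑ m, conj (col m) * φ₀ m‖ ^ 2 + ‖∑ m, conj (col m) * φ₁ m‖ ^ 2 := by
      have : s * t ^ 2 = 1 := by rw [mul_comm]; exact ht2
      calc _ = (s * t ^ 2) * (‖∑ m, conj (col m) * φ₀ m‖ ^ 2 + ‖∑ m, conj (col m) * φ₁ m‖ ^ 2) := by ring
        _ = _ := by rw [this, one_mul]
    rw [e2] at this
    exact this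
  · -- s = 0: both φ vanish
    have hz : ∀ φ : κ → ℂ, (∑ m, ‖φ m‖ ^ 2) = s → ∀ m, φ m = 0 := by
      intro φ hφ m
      rw [← hs] at hφ
      have := (Finset.sum_eq_zero_iff_of_nonneg fun m _ => by positivity).1 hφ m (Finset.mem_univ m)
      exact norm_eq_zero.1 ((pow_eq_zero_iff two_ne_zero).1 this)
    have e0 : (∑ m, conj (col m) * φ₀ m) = 0 := Finset.sum_eq_zero fun m _ => by rw [hz φ₀ h₀ m, mul_zero]
    have e1 : (∑ m, conj (col m) * φ₁ m) = 0 := Finset.sum_eq_zero fun m _ => by rw [hz φ₁ h₁ m, mul_zero]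
    rw [e0, e1, ← hs]; simp

/-- **Key lemma, maximally entangled case.** For HS-orthonormal `Q 0, Q 1 : κ × μ → ℂ`, an orthonormal pair
`w 0, w 1` in `ℂ^{2×2}`, and an orthogonal pair `φ 0 ⊥ φ 1` of equal norm `s`:
`∑_r ∑_c |∑_{(k,i)} conj(w r (k,i)) (Q_k* φ_i)(c)|² ≤ 2 s`. -/
theorem key_case_ME {κ μ : Type*} [Fintype κ] [Fintype μ]
    (Q : Fin 2 → κ × μ → ℂ) (hQn : ∀ k, (∑ c, ‖Q k c‖ ^ 2) = 1)
    (w : Fin 2 → Fin 2 × Fin 2 → ℂ)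
    (hw₀ : (∑ a, ‖w 0 a‖ ^ 2) = 1) (hw₁ : (∑ a, ‖w 1 a‖ ^ 2) = 1) (hw₀₁ : (∑ a, conj (w 0 a) * w 1 a) = 0)
    (φ : Fin 2 → κ → ℂ) (s : ℝ) (hs₀ : (∑ m, ‖φ 0 m‖ ^ 2) = s) (hs₁ : (∑ m, ‖φ 1 m‖ ^ 2) = s)
    (horth : (∑ m, conj (φ 0 m) * φ 1 m) = 0) :
    (∑ r, ∑ c, ‖∑ a : Fin 2 × Fin 2, conj (w r a) * ∑ m, conj (Q a.1 (m, c)) * φ a.2 m‖ ^ 2) ≤ 2 * s := by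
  have h1 := bessel_pair_vec w (fun a c => ∑ m, conj (Q a.1 (m, c)) * φ a.2 m) hw₀ hw₁ hw₀₁
  refine le_trans h1 ?_
  -- ∑_{(k,i)} ∑_c |⟪col_{k,c}, φ_i⟫|² ≤ ∑_k s ‖Q_k‖² = 2 s
  rw [Fintype.sum_prod_type]
  simp only [Fin.sum_univ_two]
  have hcol : ∀ k : Fin 2, (∑ c, ‖∑ m, conj (Q k (m, c)) * φ 0 m‖ ^ 2) + (∑ c, ‖∑ m, conj (Q k (m, c)) * φ 1 m‖ ^ 2) ≤ s := by
    intro k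
    rw [← Finset.sum_add_distrib]
    calc (∑ c, (‖∑ m, conj (Q k (m, c)) * φ 0 m‖ ^ 2 + ‖∑ m, conj (Q k (m, c)) * φ 1 m‖ ^ 2))
        ≤ ∑ c, s * ∑ m, ‖Q k (m, c)‖ ^ 2 :=
          Finset.sum_le_sum fun c _ => bessel_pair_scaled (φ 0) (φ 1) (fun m => Q k (m, c)) s hs₀ hs₁ horth
      _ = s * ∑ c' : κ × μ, ‖Q k c'‖ ^ 2 := by
          rw [← Finset.mul_sum, Fintype.sum_prod_type, Finset.sum_comm]
      _ = s := by rw [hQn k, mul_one]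
  have := hcol 0
  have := hcol 1
  linarith

end Summit.MatrixMultiplication.MatrixMultiplication.Theorems.RankTwoAdditivity
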